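import Mathlib.Algebra.MvPolynomial.CommRing
import Mathlib.Algebra.MvPolynomial.Degrees
import Mathlib.Algebra.Polynomial.AlgebraMap
import Mathlib.Combinatorics.Nullstellensatz
import Mathlib.FieldTheory.Finite.Basic
import Mathlib.Algebra.CharP.Basic
import HarnessLib

/-!
# Slope-method kit: four small generic facts for THEOREM B_Z{Y,Z} (instrument for the `W(f)` toy model — NOT a resolution theorem)

Engine 1 of the RESOLUTION OBSERVATORY toy model `W(f)` (weighted-centre invariant in characteristic `p`; cell notes
RE-DERIVATION-eng1-g42 §3 "THE SLOPE METHOD", CARVER-NOTES-eng1-g42 §3, theorem T99a) uses, besides the instruments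
already in the `WeightedCentre*` series, the following four generic facts (all ours, bookkeeping):

* `aeval_injective_of_leftInverse`, `polynomial_aeval_injective_of_leftInverse` (§3.4 LEMMA α: "the elements
  `u_j := σ^p z_j` are algebraically independent over `k[ε_{N∖Z}]`") — a substitution with a substitution left inverse on
  the generators is injective; the model instance `aeval_X_pow_mul_X_injective`: `s ↦ σ^n z` is injective on `S[s]`
  (left inverse `σ ↦ 1, z ↦ s`), so `Q(σ^n z) = 0 ⇒ Q = 0`;
* `sum_range_natCast_pow_eq_zero` (§3.3 / RE-DERIVATION-eng1-g41 A_Z (3): "`S_a(p) = Σ_{i ∈ F_p} i^a = 0` for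
  `a < p - 1`") — in any commutative ring of prime characteristic `p`: `Σ_{i<p} (i : K)^a = 0` for `a < p - 1`
  (from Mathlib's `FiniteField.sum_pow_lt_card_sub_one` on `ZMod p`);
* `exists_eval_natCast_ne_zero` (§3.7 "there is `z⁰ ∈ k^{n_Z}` with `C(z⁰) ≠ 0`": a nonzero polynomial all of whose
  partial degrees are `< p` has a non-vanishing point with coordinates in the prime field, given as naturals `< p`) — from
  Mathlib's grid lemma `MvPolynomial.eq_zero_of_eval_zero_at_prod_finset` and `CharP.natCast_injOn_Iio`;
* `eq_zero_of_units_pow_sub_pow_smul` (§3.3 (a): "`(μ^j - μ^{j₀}) A = 0` for all `μ ∈ F_p^×` forces `A = 0` unless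
  `p - 1 ∣ j - j₀`") — for a `ZMod p`-module, via a generator of the cyclic group `(ZMod p)ˣ` of order `p - 1`.

Also relevant and ALREADY in Mathlib (no wrapper needed): `Polynomial.expand_injective` (§3.3 (d): "`T ↦ σ^{j₀}` is
injective on `k[T][ε]`", with `Polynomial.expand`), `FiniteField.sum_pow_units` / `WeightedCentreCharacterSum` (LEMMA C).

VALUE: bookkeeping for a toy model (Resolution Observatory cell `pub-rosobs`, carver lane gen 62; AI-written Lean, and AI
review is weaker than expert review); NOT a statement about the invariant of [AbramovichTemkinWlodarczyk2024], NOT progress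
on the summit.  References for the algebra: [Lang2002, Ch. IV §1] (polynomial substitutions; Thm. 1.9: a finite
multiplicative subgroup of a field is cyclic), [Lang2002, Ch. V §5] (finite fields).
-/

namespace Literature.AlgebraicGeometry.Resolution.WeightedBlowup

namespace SlopeKit

open MvPolynomial Finset

section Injective

variable {R : Type*} [CommRing R]

/-- (ours, bookkeeping) A substitution of generators `aeval f` that admits a substitution `aeval g` sending each `f a`
back to `X a` is injective. [cite: Lang2002, Ch. IV §1] -/
theorem aeval_injective_of_leftInverse {α β : Type*} (f : α → MvPolynomial β R) (g : β → MvPolynomial α R)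
    (h : ∀ a, aeval g (f a) = X a) :
    Function.Injective (aeval f : MvPolynomial α R →ₐ[R] MvPolynomial β R) := by
  have hcomp : (aeval g).comp (aeval f) = AlgHom.id R (MvPolynomial α R) :=
    MvPolynomial.algHom_ext fun a => by rw [AlgHom.comp_apply, aeval_X, h, AlgHom.id_apply]
  intro P Q hPQ
  have h' := congrArg (aeval g) hPQ
  rwa [← AlgHom.comp_apply, ← AlgHom.comp_apply, hcomp, AlgHom.id_apply, AlgHom.id_apply] at h'

/-- (ours, bookkeeping) Univariate form: `Polynomial.aeval x : S[s] → A` is injective as soon as some `S`-algebra map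
`ψ : A → S[s]` sends `x` back to `s`. [cite: Lang2002, Ch. IV §1] -/
theorem polynomial_aeval_injective_of_leftInverse {S A : Type*} [CommRing S] [CommRing A] [Algebra S A] (x : A)
    (ψ : A →ₐ[S] Polynomial S) (h : ψ x = Polynomial.X) :
    Function.Injective (Polynomial.aeval x : Polynomial S →ₐ[S] A) := by
  have hcomp : ψ.comp (Polynomial.aeval x) = AlgHom.id S (Polynomial S) :=
    Polynomial.algHom_ext (by rw [AlgHom.comp_apply, Polynomial.aeval_X, h, AlgHom.id_apply])
  intro P Q hPQ
  have h' := congrArg ψ hPQ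
  rwa [← AlgHom.comp_apply, ← AlgHom.comp_apply, hcomp, AlgHom.id_apply, AlgHom.id_apply] at h'

/-- (ours, bookkeeping) The model instance of LEMMA α's "algebraic independence of `σ^p z_j`": in `S[σ, z]`
(`= MvPolynomial (Fin 2) S`, `σ = X 0`, `z = X 1`) the substitution `s ↦ σ^n z` is injective on `S[s]`, because
`σ ↦ 1, z ↦ s` is a left inverse.  So `Q(σ^n z) = 0` forces `Q = 0`. [cite: Lang2002, Ch. IV §1] -/
theorem aeval_X_pow_mul_X_injective {S : Type*} [CommRing S] (n : ℕ) :
    Function.Injective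
      (Polynomial.aeval ((X 0 ^ n * X 1 : MvPolynomial (Fin 2) S)) : Polynomial S →ₐ[S] MvPolynomial (Fin 2) S) := by
  refine polynomial_aeval_injective_of_leftInverse _ (MvPolynomial.aeval ![1, Polynomial.X]) ?_
  rw [map_mul, map_pow, aeval_X, aeval_X]
  simp

end Injective

section PowerSums

/-- (ours, bookkeeping) **`S_a(p) = 0`**: in a commutative ring of prime characteristic `p`, `Σ_{i<p} i^a = 0` for every
`a < p - 1` (for `a = 0` this is `p = 0`). [cite: Lang2002, Ch. V §5] -/
theorem sum_range_natCast_pow_eq_zero {K : Type*} [CommRing K] (p : ℕ) [Fact p.Prime] [CharP K p] {a : ℕ}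
    (ha : a < p - 1) : ∑ i ∈ range p, ((i : ℕ) : K) ^ a = 0 := by
  have h1 : ∑ i ∈ range p, ((i : ℕ) : ZMod p) ^ a = ∑ x : ZMod p, x ^ a := by
    refine Finset.sum_nbij' (fun i => ((i : ℕ) : ZMod p)) (fun x => x.val) (fun _ _ => Finset.mem_univ _)
      (fun x _ => Finset.mem_range.mpr (ZMod.val_lt x)) (fun i hi => ?_) (fun x _ => ZMod.natCast_zmod_val x)
      (fun _ _ => rfl)
    exact ZMod.val_cast_of_lt (Finset.mem_range.mp hi)
  have h2 : ∑ x : ZMod p, x ^ a = 0 :=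
    FiniteField.sum_pow_lt_card_sub_one (ZMod p) a (by rwa [ZMod.card])
  have h3 := congrArg (ZMod.castHom (dvd_refl p) K) (h1.trans h2)
  rw [map_sum, map_zero] at h3
  simpa only [map_pow, map_natCast] using h3

end PowerSums

section Nonvanishing

/-- (ours, bookkeeping) **A prime-field point where `P ≠ 0`**: over a domain of characteristic `p`, a nonzero polynomial in
finitely many variables all of whose partial degrees are `< p` does not vanish at some point with coordinates
`0, 1, …, p-1` (the image of `F_p`).  [In the engine: `C ≠ 0` of degree `≤ p - 2` has `C(z⁰) ≠ 0` for some `z⁰`.]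
[cite: Lang2002, Ch. IV §1] -/
theorem exists_eval_natCast_ne_zero {K : Type*} [CommRing K] [IsDomain K] (p : ℕ) [CharP K p] {σ : Type*} [Finite σ]
    {P : MvPolynomial σ K} (hP : P ≠ 0) (hdeg : ∀ i, P.degreeOf i < p) :
    ∃ x : σ → ℕ, (∀ i, x i < p) ∧ eval (fun i => (x i : K)) P ≠ 0 := by
  classical
  by_contra hcon
  simp only [not_exists, not_and, not_not] at hcon
  apply hP
  refine MvPolynomial.eq_zero_of_eval_zero_at_prod_finset P (fun _ => (Finset.range p).image (Nat.cast : ℕ → K))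
    (fun i => ?_) (fun x hx => ?_)
  · rw [Finset.card_image_of_injOn, Finset.card_range]
    · exact hdeg i
    · rw [Finset.coe_range]
      exact CharP.natCast_injOn_Iio K p
  · choose n hn hxn using fun i => Finset.mem_image.mp (hx i)
    have hx' : x = fun i => ((n i : ℕ) : K) := funext fun i => (hxn i).symm
    rw [hx']
    exact hcon n fun i => Finset.mem_range.mp (hn i)

/-- (ours, bookkeeping) The same with total degree: `totalDegree P < p` suffices. [cite: Lang2002, Ch. IV §1] -/
theorem exists_eval_natCast_ne_zero_of_totalDegree_lt {K : Type*} [CommRing K] [IsDomain K] (p : ℕ) [CharP K p]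
    {σ : Type*} [Finite σ] {P : MvPolynomial σ K} (hP : P ≠ 0) (hdeg : P.totalDegree < p) :
    ∃ x : σ → ℕ, (∀ i, x i < p) ∧ eval (fun i => (x i : K)) P ≠ 0 :=
  exists_eval_natCast_ne_zero p hP fun i => (degreeOf_le_totalDegree P i).trans_lt hdeg

end Nonvanishing

section Characters

/-- (ours, bookkeeping) **Character comparison**: if `(μ^j - μ^{j₀}) • A = 0` for every unit `μ` of `ZMod p` and
`j ≢ j₀ (mod p - 1)`, then `A = 0` — take `μ` a generator of the cyclic group `(ZMod p)ˣ` (order `p - 1`), for which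
`μ^j ≠ μ^{j₀}`. [cite: Lang2002, Ch. IV §1, Thm. 1.9] -/
theorem eq_zero_of_units_pow_sub_pow_smul (p : ℕ) [Fact p.Prime] {M : Type*} [AddCommGroup M] [Module (ZMod p) M]
    {A : M} {j j₀ : ℕ} (h : ∀ μ : (ZMod p)ˣ, ((μ : ZMod p) ^ j - (μ : ZMod p) ^ j₀) • A = 0)
    (hj : ¬ j ≡ j₀ [MOD p - 1]) : A = 0 := by
  obtain ⟨g, hg⟩ := IsCyclic.exists_ofOrder_eq_natCard (α := (ZMod p)ˣ)
  rw [Nat.card_eq_fintype_card, ZMod.card_units] at hg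
  have hne : g ^ j ≠ g ^ j₀ := by
    rw [Ne, pow_eq_pow_iff_modEq, hg]
    exact hj
  have hne' : (g : ZMod p) ^ j - (g : ZMod p) ^ j₀ ≠ 0 := by
    rw [sub_ne_zero, ← Units.val_pow_eq_pow_val, ← Units.val_pow_eq_pow_val]
    exact fun e => hne (Units.ext e)
  have hA := h g
  rw [← inv_smul_smul₀ hne' A, hA, smul_zero]

/-- (ours, bookkeeping) The arithmetic side condition in its simplest range: `1 ≤ j₀ < j ≤ p - 1` gives
`¬ j ≡ j₀ [MOD p - 1]` (the engine's finer case analysis of RE-DERIVATION-eng1-g42 §3.3 (a)–(b) is not reproduced here).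
[cite: Lang2002, Ch. IV §1] -/
theorem not_modEq_of_lt_of_lt {p j j₀ : ℕ} (hj₀ : 1 ≤ j₀) (hlt : j₀ < j) (hj : j ≤ p - 1) : ¬ j ≡ j₀ [MOD p - 1] := by
  intro hmod
  have hd := (Nat.modEq_iff_dvd' hlt.le).mp hmod.symm
  have hpos : 0 < j - j₀ := Nat.sub_pos_of_lt hlt
  have hle := Nat.le_of_dvd hpos hd
  omega

end Characters

/-! ## Smoke tests -/

section Smoke

/-- Smoke test (ours): `S_1(3) = 0 + 1 + 2 = 0` in `ZMod 3`. -/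
example : ∑ i ∈ range 3, ((i : ℕ) : ZMod 3) ^ 1 = 0 :=
  haveI : Fact (Nat.Prime 3) := ⟨Nat.prime_three⟩
  sum_range_natCast_pow_eq_zero 3 (by norm_num)

/-- Smoke test (ours): `Q(σ² z) = 0 ⇒ Q = 0` over `ℤ`. -/
example (Q : Polynomial ℤ) (hQ : Polynomial.aeval ((X 0 ^ 2 * X 1 : MvPolynomial (Fin 2) ℤ)) Q = 0) : Q = 0 :=
  aeval_X_pow_mul_X_injective (S := ℤ) 2 (by rw [hQ, map_zero])

end Smoke

end SlopeKit

end Literature.AlgebraicGeometry.Resolution.WeightedBlowup
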